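import Summits.NavierStokesRegularity.NavierStokesRegularity.Theorems.PerpetualPumpAveragedTypeIBlowupChainODE
import Mathlib.MeasureTheory.Integral.DominatedConvergence
import Mathlib.Analysis.SpecialFunctions.ExpDeriv
import Mathlib.Analysis.Calculus.Deriv.MeanValue
import Mathlib.Analysis.SpecialFunctions.Pow.Real

/-!
# Crux `PerpetualPump.AveragedTypeIBlowup` (stmt-NavierStokesRegularity-1835), line `Sketch`:
# tools for the stub `chainCritical` — pinched kernels, kernel majorants, the explicit derivative

T. Tao, *Finite time blowup for an averaged three-dimensional Navier–Stokes equation*, J. Amer.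
Math. Soc. **29** (2016), 601–674 = arXiv:1402.0290v3, §4, p. 22 (4.14): pairing the wavelet
Duhamel formula with `ψ_{i,n}` gives the exact Volterra chain of the coefficients,
`Y_{i,n}(t) = A 1_{(i,n)=(i₀,n₀)} K_{i,n}(t) + ∫₀ᵗ K_{i,n}(t-s) quadTerm(Y)_{i,n}(s) ds`.

Helper file (theorems only) for the registered stub `stub_chainCritical` of the lead's skeleton
`Cruxes/AveragedTypeIBlowup/Lines/Sketch.lean` (the Layer-1 → Layer-2 bridge: the chain, in critical
variables and with kernel majorants, solves the critical Toda system with memory errors) and its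
companion `stub_chainCriticalC1`. Contents, all elementary:

* `chainCritical_weight_identities` — the scale-weight algebra `Pₖλₖ = L^{2k}Pₖ²`,
  `Pₖλₖ₋₁ = L^{2k}Pₖ₋₁²/q³`, `Pₖλₖ = L^{2k}PₖPₖ₊₁/q` (`L = 1+ε₀`, `Pₖ = L^{k/2}`, `λₖ = L^{5k/2}`,
  `q = √L`) that turns the Toda closed forms of the drive into the critical nonlinearities;
* `chainCritical_kernel_decay` — `D g ≤ -g'` on `τ ≥ 0` gives `g(τ₂) ≤ e^{-D(τ₂-τ₁)} g(τ₁)`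
  (`g e^{Dτ}` is non-increasing, `antitoneOn_of_hasDerivWithinAt_nonpos`);
* `chainCritical_volterra_continuousOn`, `chainCritical_abs_le_majorant`,
  `chainCritical_majorant_restart` — continuity of `t ↦ ∫₀ᵗ g(t-s)|φ(s)| ds`, domination of the chain
  by its kernel majorant, and the restart (Duhamel) inequality of the majorant at rate `D`;
* `chainCritical_hasDerivAt_explicit`, `chainCritical_continuous_explicit`,
  `chainCritical_explicit_estimate` — the EXPLICIT derivative
  `A1·(-K₁)(t) + Q̃(t) + ∫₀ᵗ (-K₁(t-s)) Q̃(s) ds` of a chain solution (`Q̃` = the drive clamped to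
  `[0,T]`; Leibniz rule `hasDerivAt_volterra_kernel` of the `chainODE` file), its continuity, and its
  memory-error estimate (from `stub_chainODE` by uniqueness of the derivative);
* `chainCritical_exists_error`, `chainCritical_abs_error_le` — passing a constant weight through the
  error form of the ODE;
* `stub_chainCriticalTools` — the registered tools stub (decay ∧ restart ∧ domination).

Nothing here closes the item (`--supports`); no statement of the route changes.

## References

* T. Tao, J. Amer. Math. Soc. 29 (2016), 601–674, arXiv:1402.0290v3, §4 p. 22 (4.14).
  [`Tao2016AveragedNS`]
-/

noncomputable section

-- the summit namespace `…NavierStokesRegularity.NavierStokesRegularity…` is the tree convention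
set_option linter.dupNamespace false

open MeasureTheory Set Filter Topology
open scoped ENNReal
open Literature.Analysis.FluidPDE
open Literature.Analysis.FluidPDE.TaoCascade (quadTerm)

namespace Summit.NavierStokesRegularity.NavierStokesRegularity.Theorems.PerpetualPumpAveragedTypeIBlowup

variable {ε₀ : ℝ}

/-! ### Scale-weight algebra of the critical variables -/

/-- **The scale-weight identities behind the critical variables.** With `L = 1+ε₀`, `Pₖ = L^{k/2}`,
`λₖ = L^{5k/2}`, `q = √L`: `Pₖ λₖ = L^{2k} Pₖ²`, `Pₖ λₖ₋₁ = L^{2k} Pₖ₋₁² / q³` and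
`Pₖ λₖ = L^{2k} Pₖ Pₖ₊₁ / q` (everything is `exp` of a multiple of `log L`). [folklore] -/
theorem chainCritical_weight_identities {L : ℝ} (hL : 0 < L) (k : ℤ) :
    L ^ ((k : ℝ) / 2) * L ^ ((5 : ℝ) * (k : ℝ) / 2) = L ^ (2 * k) * (L ^ ((k : ℝ) / 2)) ^ 2 ∧
    L ^ ((k : ℝ) / 2) * L ^ ((5 : ℝ) * ((k : ℝ) - 1) / 2) =
      L ^ (2 * k) * (L ^ (((k - 1 : ℤ) : ℝ) / 2)) ^ 2 / Real.sqrt L ^ 3 ∧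
    L ^ ((k : ℝ) / 2) * L ^ ((5 : ℝ) * (k : ℝ) / 2) =
      L ^ (2 * k) * L ^ ((k : ℝ) / 2) * L ^ (((k + 1 : ℤ) : ℝ) / 2) / Real.sqrt L := by
  have hz : L ^ (2 * k) = Real.exp (Real.log L * (2 * (k : ℝ))) := by
    rw [← Real.rpow_def_of_pos hL, ← Real.rpow_intCast]
    push_cast
    ring_nf
  have hs : Real.sqrt L = Real.exp (Real.log L * (1 / 2)) := by
    rw [Real.sqrt_eq_rpow, Real.rpow_def_of_pos hL]
  simp only [Real.rpow_def_of_pos hL, hz, hs, pow_succ, pow_zero, one_mul, ← Real.exp_add,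
    ← Real.exp_sub]
  refine ⟨?_, ?_, ?_⟩ <;> congr 1 <;> push_cast <;> ring

/-! ### Pinched kernels: logarithmic decay -/

/-- **Logarithmic decay of a pinched kernel**: if `g' = g₁` everywhere and `D g ≤ -g₁` on `τ ≥ 0`,
then `g(τ₂) ≤ e^{-D(τ₂-τ₁)} g(τ₁)` for `0 ≤ τ₁ ≤ τ₂` (the function `g(τ) e^{Dτ}` is non-increasing on
`[0,∞)`). [folklore] -/
theorem chainCritical_kernel_decay {g g₁ : ℝ → ℝ} {D : ℝ} (hg : ∀ τ, HasDerivAt g (g₁ τ) τ)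
    (hD : ∀ τ, 0 ≤ τ → D * g τ ≤ -g₁ τ) {τ₁ τ₂ : ℝ} (h₁ : 0 ≤ τ₁) (h₁₂ : τ₁ ≤ τ₂) :
    g τ₂ ≤ Real.exp (-(D * (τ₂ - τ₁))) * g τ₁ := by
  have hderiv : ∀ τ, HasDerivAt (fun σ => g σ * Real.exp (D * σ))
      (g₁ τ * Real.exp (D * τ) + g τ * (Real.exp (D * τ) * (D * 1))) τ := fun τ =>
    (hg τ).mul ((hasDerivAt_id' τ).const_mul D).exp
  have hanti : AntitoneOn (fun σ => g σ * Real.exp (D * σ)) (Ici 0) := by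
    refine antitoneOn_of_hasDerivWithinAt_nonpos (convex_Ici 0)
      (fun τ _ => (hderiv τ).continuousAt.continuousWithinAt)
      (fun τ _ => (hderiv τ).hasDerivWithinAt) fun τ hτ => ?_
    rw [interior_Ici] at hτ
    have h := hD τ (le_of_lt hτ)
    have he : g₁ τ * Real.exp (D * τ) + g τ * (Real.exp (D * τ) * (D * 1)) =
        (g₁ τ + D * g τ) * Real.exp (D * τ) := by ring
    rw [he]
    exact mul_nonpos_of_nonpos_of_nonneg (by linarith) (Real.exp_pos _).le
  have hle := hanti (mem_Ici.2 h₁) (mem_Ici.2 (h₁.trans h₁₂)) h₁₂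
  simp only at hle
  rw [show -(D * (τ₂ - τ₁)) = D * τ₁ - D * τ₂ by ring, Real.exp_sub, div_mul_eq_mul_div,
    le_div_iff₀ (Real.exp_pos _)]
  linarith [mul_comm (Real.exp (D * τ₁)) (g τ₁)]

/-! ### Volterra terms against a kernel: continuity, majorant bounds, restart -/

/-- Continuity of `t ↦ ∫₀ᵗ g(t-s) |φ(s)| ds` on `[0,T']`, for `g` continuous and `φ` continuous on
`[0,T']` (clamp `φ` to `[0,T']`; joint continuity of the parametric integral). [folklore] -/
theorem chainCritical_volterra_continuousOn {g φ : ℝ → ℝ} (hg : Continuous g) {T' : ℝ} (hT' : 0 ≤ T')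
    (hφ : ContinuousOn φ (Icc 0 T')) :
    ContinuousOn (fun t => ∫ s in (0 : ℝ)..t, g (t - s) * |φ s|) (Icc 0 T') := by
  have hclamp : ∀ s : ℝ, max 0 (min T' s) ∈ Icc 0 T' := fun s =>
    ⟨le_max_left _ _, max_le hT' (min_le_left _ _)⟩
  have hψ : Continuous fun s => |φ (max 0 (min T' s))| :=
    continuous_abs.comp
      (hφ.comp_continuous (continuous_const.max (continuous_const.min continuous_id)) hclamp)
  have hV : Continuous fun t => ∫ s in (0 : ℝ)..t, g (t - s) * |φ (max 0 (min T' s))| :=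
    intervalIntegral.continuous_parametric_intervalIntegral_of_continuous
      (f := fun t s => g (t - s) * |φ (max 0 (min T' s))|)
      ((hg.comp (continuous_fst.sub continuous_snd)).mul (hψ.comp continuous_snd)) continuous_id
  refine hV.continuousOn.congr fun t ht => ?_
  refine intervalIntegral.integral_congr fun s hs => ?_
  rw [uIcc_of_le ht.1] at hs
  rw [min_eq_right (hs.2.trans ht.2), max_eq_right hs.1]

/-- **The kernel majorant dominates**: if `y = a g(t) + ∫₀ᵗ g(t-s) φ(s) ds` with `g ≥ 0` on `τ ≥ 0`,
then `|y| ≤ |a| g(t) + ∫₀ᵗ g(t-s) |φ(s)| ds`, and the majorant is nonnegative. [folklore] -/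
theorem chainCritical_abs_le_majorant {g φ : ℝ → ℝ} (hg : Continuous g) (hgnn : ∀ τ, 0 ≤ τ → 0 ≤ g τ) {S : ℝ}
    (hφ : ContinuousOn φ (Ico 0 S)) {a y t : ℝ} (ht : t ∈ Ico 0 S)
    (hy : y = a * g t + ∫ s in (0 : ℝ)..t, g (t - s) * φ s) :
    |y| ≤ |a| * g t + ∫ s in (0 : ℝ)..t, g (t - s) * |φ s| ∧
      0 ≤ |a| * g t + ∫ s in (0 : ℝ)..t, g (t - s) * |φ s| := by
  have hφc : ContinuousOn φ (uIcc 0 t) := by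
    rw [uIcc_of_le ht.1]
    exact hφ.mono (Icc_subset_Ico_right ht.2)
  have hI : IntervalIntegrable (fun s => g (t - s) * |φ s|) volume 0 t :=
    ((hg.comp (continuous_const.sub continuous_id)).continuousOn.mul
      (continuous_abs.comp_continuousOn hφc)).intervalIntegrable
  have hnn : 0 ≤ ∫ s in (0 : ℝ)..t, g (t - s) * |φ s| :=
    intervalIntegral.integral_nonneg ht.1 fun s hs =>
      mul_nonneg (hgnn _ (sub_nonneg.2 hs.2)) (abs_nonneg _)
  refine ⟨?_, add_nonneg (mul_nonneg (abs_nonneg a) (hgnn t ht.1)) hnn⟩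
  rw [hy]
  refine (abs_add_le _ _).trans (add_le_add ?_ ?_)
  · rw [abs_mul, abs_of_nonneg (hgnn t ht.1)]
  · rw [← Real.norm_eq_abs]
    refine intervalIntegral.norm_integral_le_of_norm_le ht.1 (Eventually.of_forall fun s hs => ?_) hI
    rw [Real.norm_eq_abs, abs_mul, abs_of_nonneg (hgnn _ (sub_nonneg.2 hs.2))]

/-- **Restart (Duhamel) inequality for the kernel majorant.** If `g' = g₁`, `D g ≤ -g₁` on `τ ≥ 0`
and `g(0) = 1`, then for `0 ≤ t₁ ≤ t₂ ≤ T'` and `φ` continuous on `[0,T']`,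
`a g(t₂) + ∫₀^{t₂} g(t₂-s)|φ| ≤ (a g(t₁) + ∫₀^{t₁} g(t₁-s)|φ|) e^{-D(t₂-t₁)} + ∫_{t₁}^{t₂} e^{-D(t₂-u)}|φ(u)| du`
(`a ≥ 0`): split the memory at `t₁` and use the logarithmic decay of `g` on each piece. [folklore] -/
theorem chainCritical_majorant_restart {g g₁ φ : ℝ → ℝ} {D T' a : ℝ} (hg : ∀ τ, HasDerivAt g (g₁ τ) τ)
    (hD : ∀ τ, 0 ≤ τ → D * g τ ≤ -g₁ τ) (hg0 : g 0 = 1) (hφ : ContinuousOn φ (Icc 0 T'))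
    (ha : 0 ≤ a) {t₁ t₂ : ℝ} (h₁ : 0 ≤ t₁) (h₁₂ : t₁ ≤ t₂) (h₂ : t₂ ≤ T') :
    a * g t₂ + ∫ s in (0 : ℝ)..t₂, g (t₂ - s) * |φ s| ≤
      (a * g t₁ + ∫ s in (0 : ℝ)..t₁, g (t₁ - s) * |φ s|) * Real.exp (-(D * (t₂ - t₁))) +
        ∫ u in t₁..t₂, Real.exp (-(D * (t₂ - u))) * |φ u| := by
  have hgc : Continuous g := continuous_iff_continuousAt.2 fun τ => (hg τ).continuousAt
  have hφabs : ContinuousOn (fun s => |φ s|) (Icc 0 T') := continuous_abs.comp_continuousOn hφ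
  have hint : ∀ u b c : ℝ, 0 ≤ b → c ≤ T' → b ≤ c →
      IntervalIntegrable (fun s => g (u - s) * |φ s|) volume b c := by
    intro u b c hb hc hbc
    refine ((hgc.comp (continuous_const.sub continuous_id)).continuousOn.mul
      (hφabs.mono ?_)).intervalIntegrable
    rw [uIcc_of_le hbc]
    exact Icc_subset_Icc hb hc
  have h0T : t₁ ≤ T' := h₁₂.trans h₂
  -- (i) the datum term
  have hE1 : a * g t₂ ≤ a * g t₁ * Real.exp (-(D * (t₂ - t₁))) :=
    calc a * g t₂ ≤ a * (Real.exp (-(D * (t₂ - t₁))) * g t₁) :=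
          mul_le_mul_of_nonneg_left (chainCritical_kernel_decay hg hD h₁ h₁₂) ha
      _ = a * g t₁ * Real.exp (-(D * (t₂ - t₁))) := by ring
  -- (ii) split the memory at `t₁`
  have hsplit : ∫ s in (0 : ℝ)..t₂, g (t₂ - s) * |φ s| =
      (∫ s in (0 : ℝ)..t₁, g (t₂ - s) * |φ s|) + ∫ s in t₁..t₂, g (t₂ - s) * |φ s| :=
    (intervalIntegral.integral_add_adjacent_intervals (hint t₂ 0 t₁ le_rfl h0T h₁)
      (hint t₂ t₁ t₂ h₁ h₂ h₁₂)).symm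
  -- (iii) the old memory decays
  have hE2 : ∫ s in (0 : ℝ)..t₁, g (t₂ - s) * |φ s| ≤
      (∫ s in (0 : ℝ)..t₁, g (t₁ - s) * |φ s|) * Real.exp (-(D * (t₂ - t₁))) := by
    rw [← intervalIntegral.integral_mul_const]
    refine intervalIntegral.integral_mono_on h₁ (hint t₂ 0 t₁ le_rfl h0T h₁)
      ((hint t₁ 0 t₁ le_rfl h0T h₁).mul_const _) fun s hs => ?_
    have hk := chainCritical_kernel_decay hg hD (sub_nonneg.2 hs.2) (sub_le_sub_right h₁₂ s)
    rw [show t₂ - s - (t₁ - s) = t₂ - t₁ by ring] at hk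
    calc g (t₂ - s) * |φ s| ≤ Real.exp (-(D * (t₂ - t₁))) * g (t₁ - s) * |φ s| :=
          mul_le_mul_of_nonneg_right hk (abs_nonneg _)
      _ = g (t₁ - s) * |φ s| * Real.exp (-(D * (t₂ - t₁))) := by ring
  -- (iv) the new memory against the free decay
  have hE3 : ∫ s in t₁..t₂, g (t₂ - s) * |φ s| ≤
      ∫ u in t₁..t₂, Real.exp (-(D * (t₂ - u))) * |φ u| := by
    refine intervalIntegral.integral_mono_on h₁₂ (hint t₂ t₁ t₂ h₁ h₂ h₁₂) ?_ fun s hs => ?_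
    · refine ((Real.continuous_exp.comp (continuous_const.mul
        (continuous_const.sub continuous_id)).neg).continuousOn.mul (hφabs.mono ?_)).intervalIntegrable
      rw [uIcc_of_le h₁₂]
      exact Icc_subset_Icc h₁ h₂
    · have hk := chainCritical_kernel_decay hg hD le_rfl (sub_nonneg.2 hs.2)
      rw [sub_zero, hg0, mul_one] at hk
      exact mul_le_mul_of_nonneg_right hk (abs_nonneg _)
  rw [hsplit]
  calc a * g t₂ + ((∫ s in (0 : ℝ)..t₁, g (t₂ - s) * |φ s|) + ∫ s in t₁..t₂, g (t₂ - s) * |φ s|)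
      ≤ a * g t₁ * Real.exp (-(D * (t₂ - t₁))) +
          ((∫ s in (0 : ℝ)..t₁, g (t₁ - s) * |φ s|) * Real.exp (-(D * (t₂ - t₁))) +
            ∫ u in t₁..t₂, Real.exp (-(D * (t₂ - u))) * |φ u|) := add_le_add hE1 (add_le_add hE2 hE3)
    _ = _ := by ring

/-! ### From the chain-ODE error to the critical-ODE error -/

/-- Passing a constant weight `P` through the chain ODE with error: if `f' = d` at `t`,
`|d + R f(t) - Q| ≤ ηR·B` and `P Q = R G`, then `(P f)' = R(-(P f) + G) + e` with `|e| ≤ ηR |P| B`.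
[folklore] -/
theorem chainCritical_exists_error {f : ℝ → ℝ} {d t P Rn Q G B ηR : ℝ}
    (hf : HasDerivAt f d t) (hest : |d + Rn * f t - Q| ≤ ηR * B) (hkey : P * Q = Rn * G) :
    ∃ e : ℝ, |e| ≤ ηR * (|P| * B) ∧
      HasDerivAt (fun u => P * f u) (Rn * (-(P * f t) + G) + e) t := by
  refine ⟨P * (d + Rn * f t - Q), ?_, (hf.const_mul P).congr_deriv (by linear_combination hkey)⟩
  rw [abs_mul]
  calc |P| * |d + Rn * f t - Q| ≤ |P| * (ηR * B) := mul_le_mul_of_nonneg_left hest (abs_nonneg P)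
    _ = ηR * (|P| * B) := by ring

/-- The same bookkeeping for an explicit derivative: `|P d - R(-(P f) + G)| ≤ ηR |P| B`. [folklore] -/
theorem chainCritical_abs_error_le {d f P Rn Q G B ηR : ℝ} (hest : |d + Rn * f - Q| ≤ ηR * B)
    (hkey : P * Q = Rn * G) : |P * d - Rn * (-(P * f) + G)| ≤ ηR * (|P| * B) := by
  rw [show P * d - Rn * (-(P * f) + G) = P * (d + Rn * f - Q) by linear_combination hkey, abs_mul]
  calc |P| * |d + Rn * f - Q| ≤ |P| * (ηR * B) := mul_le_mul_of_nonneg_left hest (abs_nonneg P)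
    _ = ηR * (|P| * B) := by ring

/-! ### The explicit derivative of a chain solution -/

/-- **The explicit derivative of a chain solution.** For kernels with `K' = -K₁` (`K₁` continuous),
`K(0) = 1`, a continuous solution of the chain on `[0,S)` has, at every `t ∈ (0,T)`, `T < S`, the
derivative `a·(-K₁(t)) + Q̃(t) + ∫₀ᵗ (-K₁(t-s)) Q̃(s) ds`, where `Q̃` is the drive `quadTerm(Y)` clamped to
`[0,T]` (Leibniz rule `hasDerivAt_volterra_kernel`, transferred along the chain identity near `t`).
[cite: Tao2016AveragedNS, §4 p. 22 (4.14)] -/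
theorem chainCritical_hasDerivAt_explicit {α : Fin 2 → Fin 2 → Fin 2 → ℤ × ℤ × ℤ → ℝ}
    {K K₁ : Fin 2 → ℤ → ℝ → ℝ} (hK : ∀ i n τ, HasDerivAt (K i n) (-K₁ i n τ) τ)
    (hK₁ : ∀ i n, Continuous (K₁ i n)) (hK0 : ∀ i n, K i n 0 = 1) {n₀ : ℤ} {A S : ℝ}
    {Y : Fin 2 → ℤ → ℝ → ℝ} (hYc : ∀ i n, ContinuousOn (Y i n) (Ico 0 S))
    (hchain : ∀ (i : Fin 2) (n : ℤ), ∀ t ∈ Ico 0 S,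
      Y i n t = (if i = 0 ∧ n = n₀ then A else 0) * K i n t +
        ∫ s in (0 : ℝ)..t, K i n (t - s) * quadTerm ε₀ α Y i n s)
    (i : Fin 2) (n : ℤ) {T : ℝ} (hTS : T < S) {t : ℝ} (ht : t ∈ Ioo 0 T) :
    HasDerivAt (Y i n)
      ((if i = 0 ∧ n = n₀ then A else 0) * -K₁ i n t +
        (quadTerm ε₀ α Y i n (max 0 (min T t)) +
          ∫ s in (0 : ℝ)..t, -K₁ i n (t - s) * quadTerm ε₀ α Y i n (max 0 (min T s)))) t := by
  set a : ℝ := (if i = 0 ∧ n = n₀ then A else 0) with ha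
  have hT0 : 0 ≤ T := (ht.1.trans ht.2).le
  have hclamp : ∀ s : ℝ, max 0 (min T s) ∈ Icc 0 T := fun s =>
    ⟨le_max_left _ _, max_le hT0 (min_le_left _ _)⟩
  have hqc : Continuous fun s => quadTerm ε₀ α Y i n (max 0 (min T s)) :=
    ((quadTerm_continuousOn α hYc i n).mono (Icc_subset_Ico_right hTS)).comp_continuous
      (continuous_const.max (continuous_const.min continuous_id)) hclamp
  have hq_eq : ∀ s ∈ Icc 0 T, quadTerm ε₀ α Y i n (max 0 (min T s)) = quadTerm ε₀ α Y i n s :=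
    fun s hs => by rw [min_eq_right hs.2, max_eq_right hs.1]
  have hF : HasDerivAt (fun u => a * K i n u +
      ∫ s in (0 : ℝ)..u, K i n (u - s) * quadTerm ε₀ α Y i n (max 0 (min T s)))
      (a * -K₁ i n t + (K i n 0 * quadTerm ε₀ α Y i n (max 0 (min T t)) +
        ∫ s in (0 : ℝ)..t, -K₁ i n (t - s) * quadTerm ε₀ α Y i n (max 0 (min T s)))) t :=
    ((hK i n t).const_mul a).add (hasDerivAt_volterra_kernel (hK i n) (hK₁ i n).neg hqc 0 t)
  have hYF : Y i n =ᶠ[𝓝 t] fun u => a * K i n u +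
      ∫ s in (0 : ℝ)..u, K i n (u - s) * quadTerm ε₀ α Y i n (max 0 (min T s)) := by
    filter_upwards [Ioo_mem_nhds ht.1 ht.2] with u hu
    rw [hchain i n u ⟨hu.1.le, hu.2.trans hTS⟩]
    congr 1
    refine intervalIntegral.integral_congr fun s hs => ?_
    rw [uIcc_of_le hu.1.le] at hs
    rw [hq_eq s ⟨hs.1, hs.2.trans hu.2.le⟩]
  exact (hF.congr_of_eventuallyEq hYF).congr_deriv (by rw [hK0, one_mul])

/-- The explicit derivative without the datum term, `Q̃(t) + ∫₀ᵗ (-K₁(t-s)) Q̃(s) ds`, is continuous on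
`ℝ` (`0 ≤ T < S`; joint continuity of the parametric integral). [folklore] -/
theorem chainCritical_continuous_explicit {α : Fin 2 → Fin 2 → Fin 2 → ℤ × ℤ × ℤ → ℝ}
    {K₁ : Fin 2 → ℤ → ℝ → ℝ} (hK₁ : ∀ i n, Continuous (K₁ i n)) {S : ℝ}
    {Y : Fin 2 → ℤ → ℝ → ℝ} (hYc : ∀ i n, ContinuousOn (Y i n) (Ico 0 S)) (i : Fin 2) (n : ℤ)
    {T : ℝ} (hT : 0 ≤ T) (hTS : T < S) :
    Continuous fun t => quadTerm ε₀ α Y i n (max 0 (min T t)) +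
      ∫ s in (0 : ℝ)..t, -K₁ i n (t - s) * quadTerm ε₀ α Y i n (max 0 (min T s)) := by
  have hclamp : ∀ s : ℝ, max 0 (min T s) ∈ Icc 0 T := fun s =>
    ⟨le_max_left _ _, max_le hT (min_le_left _ _)⟩
  have hqc : Continuous fun s => quadTerm ε₀ α Y i n (max 0 (min T s)) :=
    ((quadTerm_continuousOn α hYc i n).mono (Icc_subset_Ico_right hTS)).comp_continuous
      (continuous_const.max (continuous_const.min continuous_id)) hclamp
  refine hqc.add ?_
  exact intervalIntegral.continuous_parametric_intervalIntegral_of_continuous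
    (f := fun t s => -K₁ i n (t - s) * quadTerm ε₀ α Y i n (max 0 (min T s)))
    (((hK₁ i n).neg.comp (continuous_fst.sub continuous_snd)).mul (hqc.comp continuous_snd))
    continuous_id

/-- **The memory-error estimate for the explicit derivative**: with pinched kernels
`D⁻ₙ K ≤ K₁ ≤ D⁺ₙ K`, `K ≥ 0` on `τ ≥ 0`, `D⁻ₙ + D⁺ₙ = 2Rₙ`, `D⁺ₙ - D⁻ₙ = 2ηRₙ`, the explicit derivative
`d` of `Y_{i,n}` at `t ∈ (0,T)` obeys `|d + Rₙ Y - Q| ≤ ηRₙ (|a| K(t) + ∫₀ᵗ K(t-s)|Q(s)| ds)`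
(`stub_chainODE` and uniqueness of the derivative). [cite: Tao2016AveragedNS, §4 p. 22 (4.14)] -/
theorem chainCritical_explicit_estimate (hε₀ : 0 < ε₀) {α : Fin 2 → Fin 2 → Fin 2 → ℤ × ℤ × ℤ → ℝ}
    {K K₁ : Fin 2 → ℤ → ℝ → ℝ} {Dlo Dhi R : ℤ → ℝ} {η : ℝ}
    (hK : ∀ i n τ, HasDerivAt (K i n) (-K₁ i n τ) τ) (hK₁ : ∀ i n, Continuous (K₁ i n))
    (hK0 : ∀ i n, K i n 0 = 1)
    (hpinch : ∀ (i : Fin 2) (n : ℤ) (τ : ℝ), 0 ≤ τ →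
      0 ≤ K i n τ ∧ Dlo n * K i n τ ≤ K₁ i n τ ∧ K₁ i n τ ≤ Dhi n * K i n τ)
    (hsum : ∀ n, Dlo n + Dhi n = 2 * R n) (hdiff : ∀ n, Dhi n - Dlo n = 2 * (η * R n))
    {n₀ : ℤ} {A S : ℝ} {Y : Fin 2 → ℤ → ℝ → ℝ} (hYc : ∀ i n, ContinuousOn (Y i n) (Ico 0 S))
    (hchain : ∀ (i : Fin 2) (n : ℤ), ∀ t ∈ Ico 0 S,
      Y i n t = (if i = 0 ∧ n = n₀ then A else 0) * K i n t +
        ∫ s in (0 : ℝ)..t, K i n (t - s) * quadTerm ε₀ α Y i n s)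
    (i : Fin 2) (n : ℤ) {T : ℝ} (hTS : T < S) {t : ℝ} (ht : t ∈ Ioo 0 T) :
    |(if i = 0 ∧ n = n₀ then A else 0) * -K₁ i n t +
        (quadTerm ε₀ α Y i n (max 0 (min T t)) +
          ∫ s in (0 : ℝ)..t, -K₁ i n (t - s) * quadTerm ε₀ α Y i n (max 0 (min T s))) +
        R n * Y i n t - quadTerm ε₀ α Y i n t| ≤
      η * R n * (|(if i = 0 ∧ n = n₀ then A else 0)| * K i n t +
        ∫ s in (0 : ℝ)..t, K i n (t - s) * |quadTerm ε₀ α Y i n s|) := by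
  have hpinch' : ∀ (i : Fin 2) (n : ℤ) (τ : ℝ), 0 ≤ τ →
      0 ≤ K i n τ ∧ Dlo n * K i n τ ≤ -(-K₁ i n τ) ∧ -(-K₁ i n τ) ≤ Dhi n * K i n τ := by
    simpa only [neg_neg] using hpinch
  have htS : t ∈ Ioo 0 S := ⟨ht.1, ht.2.trans hTS⟩
  obtain ⟨y', hy', hest⟩ := stub_chainODE hε₀ α K (fun i n τ => -K₁ i n τ) Dlo Dhi hK
    (fun i n => (hK₁ i n).neg) hK0 hpinch' 0 n₀ A S Y hYc hchain i n t htS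
  have huniq := hy'.unique (chainCritical_hasDerivAt_explicit hK hK₁ hK0 hYc hchain i n hTS ht)
  have h1 : (Dlo n + Dhi n) / 2 = R n := by rw [hsum n]; ring
  have h2 : (Dhi n - Dlo n) / 2 = η * R n := by rw [hdiff n]; ring
  rw [h1, h2, huniq] at hest
  exact hest

/-! ### The registered tools stub -/

/-- **Registered tools stub `stub_chainCriticalTools`** (line `Sketch` of crux
`PerpetualPump.AveragedTypeIBlowup`, stmt-NavierStokesRegularity-1835): the logarithmic decay
`g(τ₂) ≤ e^{-D(τ₂-τ₁)} g(τ₁)` of a pinched kernel (`D g ≤ -g'` on `τ ≥ 0`), the restart (Duhamel)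
inequality of the kernel majorant `a g(t) + ∫₀ᵗ g(t-s)|φ(s)| ds` at rate `D`, and the domination
`|a g(t) + ∫₀ᵗ g(t-s)φ(s) ds| ≤ |a| g(t) + ∫₀ᵗ g(t-s)|φ(s)| ds` (`g ≥ 0`). [folklore] -/
theorem stub_chainCriticalTools :
    (∀ (g g₁ : ℝ → ℝ) (D τ₁ τ₂ : ℝ), (∀ τ, HasDerivAt g (g₁ τ) τ) →
      (∀ τ, 0 ≤ τ → D * g τ ≤ -g₁ τ) → 0 ≤ τ₁ → τ₁ ≤ τ₂ →
      g τ₂ ≤ Real.exp (-(D * (τ₂ - τ₁))) * g τ₁) ∧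
    (∀ (g g₁ φ : ℝ → ℝ) (D T' a t₁ t₂ : ℝ), (∀ τ, HasDerivAt g (g₁ τ) τ) →
      (∀ τ, 0 ≤ τ → D * g τ ≤ -g₁ τ) → g 0 = 1 → ContinuousOn φ (Icc 0 T') → 0 ≤ a →
      0 ≤ t₁ → t₁ ≤ t₂ → t₂ ≤ T' →
      a * g t₂ + ∫ s in (0 : ℝ)..t₂, g (t₂ - s) * |φ s| ≤
        (a * g t₁ + ∫ s in (0 : ℝ)..t₁, g (t₁ - s) * |φ s|) * Real.exp (-(D * (t₂ - t₁))) +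
          ∫ u in t₁..t₂, Real.exp (-(D * (t₂ - u))) * |φ u|) ∧
    (∀ (g φ : ℝ → ℝ) (S a y t : ℝ), Continuous g → (∀ τ, 0 ≤ τ → 0 ≤ g τ) →
      ContinuousOn φ (Ico 0 S) → t ∈ Ico 0 S →
      y = a * g t + ∫ s in (0 : ℝ)..t, g (t - s) * φ s →
      |y| ≤ |a| * g t + ∫ s in (0 : ℝ)..t, g (t - s) * |φ s|) :=
  ⟨fun _ _ _ _ _ hg hD h₁ h₁₂ => chainCritical_kernel_decay hg hD h₁ h₁₂,
    fun _ _ _ _ _ _ _ _ hg hD hg0 hφ ha h₁ h₁₂ h₂ =>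
      chainCritical_majorant_restart hg hD hg0 hφ ha h₁ h₁₂ h₂,
    fun _ _ _ _ _ _ hg hgnn hφ ht hy => (chainCritical_abs_le_majorant hg hgnn hφ ht hy).1⟩

end Summit.NavierStokesRegularity.NavierStokesRegularity.Theorems.PerpetualPumpAveragedTypeIBlowup

end
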